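import Summits.Ventures.PercRepro.RankLevelSetExplicitLin2CoreOfPoly
import Summits.Ventures.PercRepro.S3SixWindow

/-!
# PercRepro — THE INTEGER KEY OF `(P_d)`, ITS MONOTONICITY IN THE RANK, AND THE LEVEL ASSEMBLY FROM ONE ROW (p9, S4)

`proofs/SUBCLAIM-S4-p9.md` §S4.3⁗. The assembled inequality `(P_d)` of THEOREM P⁗″'s chain with the saturated
weights (`c025_core_lin2_of_poly`, RankLevelSetExplicitLin2CoreOfPoly) is, with the denominators `6·μ_s·μ_b`
cleared, ONE integer inequality `KeyP q p d` in `(q, p, d)` whose binomials are written by the falling factorial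
(`chooseD`), so that the kernel evaluates it by `decide` at any numeral cell. Two facts make one evaluated ROW
`∀ d ∈ [q + 1, q + 2^q], KeyP q p₀ d` into the whole level above `p₀`:

* **`keyP_mono`** — `KeyP q p d → KeyP q (p + 1) d` (every term of the left side grows by at most the factor
  `(p + q + 1)/(p + 1)` by which `C(p + q, q)` grows: `(p + 1)·C(n + 1, j) ≤ (p + q + 1)·C(n, j)` for `j ≤ q ≤ n − p`,
  `choose_succ_ratio`), so the key at `p₀` gives the key at every `p ≥ p₀`;
* **`c025_level_succ_of_keyP_row`** — the threshold wrapper at one rank (`rls_succ_large_at`): level `q + 1` for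
  every `p ≥ p₀` from level `q` for every `p ≥ p₀ − 1`, the evaluated row at `p₀` (the core cells of corank
  `≤ q + 1 + 2^{q+1}`, through `poly_of_keyP` and `c025_core_lin2_of_poly`), and the large-corank theorem
  `c025_core_explicit_large'` (corank `> q + 1 + 2^{q+1}`, `p₀ ≥ N₁(q + 1)`).

The rows themselves (`decide` at `p₀ = 8 710 / 18 780 / 40 204 / …`, the chain's own floor at `q = 10 / 11 / 12 / …`)
are the modules RankLevelSetExplicitLin2RowTen, …Eleven, …Twelve, … . Axioms: standard.
-/

open scoped Matroid

namespace PercRepro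

namespace ThmN

namespace Explicit

/-- `C(n, k)` by the falling factorial — the kernel-computable form of `Nat.choose`. -/
def chooseD (n k : ℕ) : ℕ := n.descFactorial k / k.factorial

/-- `chooseD n k = C(n, k)`. -/
theorem chooseD_eq (n k : ℕ) : chooseD n k = n.choose k :=
  (Nat.choose_eq_descFactorial_div_factorial n k).symm

/-- `A6(q, p, d)` — the right side of the small-class bound `6A ≤ A6` of `(P_d)` (Lemma T, Lemma T4, the `T_k` tail),
kernel-computable. -/
def A6D (q p d : ℕ) : ℕ :=
  3 * (d * (d + 1)) * chooseD (p + d) (q - 2) + 2 * (d * (d + 1) * (d + 2)) * chooseD (p + d) (q - 3) +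
    6 * (chooseD (2 * d + 2 * q - 2) 4 * chooseD (2 * d + 2 * q - 6 + (p + d)) (q - 4))

/-- **THE INTEGER KEY OF `(P_d)`** at `(q, p, d)` with the saturated weights `W_s = 2^{μ_s}/μ_s`, `W_b = 2^{μ_b}/μ_b`,
`μ_s = min (5·2^{q−4} − q) d`, `μ_b = min (5·2^{q−3} − q − 1) d`, `6A = A6`, `B = C((q+3)d + 2q − 2, q)` and the
denominators `6·μ_s·μ_b` cleared:
`8·(C(p+d, q)·6μ_sμ_b + 2^{μ_s}·μ_b·A6 + 2^{μ_b}·6μ_s·C((q+3)d + 2q − 2, q)) ≤ 7·2^{d−q}·C(p+q, q)·6μ_sμ_b`. -/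
abbrev KeyP (q p d : ℕ) : Prop :=
  8 * (chooseD (p + d) q * (6 * min (5 * 2 ^ (q - 4) - q) d * min (5 * 2 ^ (q - 3) - q - 1) d) +
      2 ^ (min (5 * 2 ^ (q - 4) - q) d) * min (5 * 2 ^ (q - 3) - q - 1) d * A6D q p d +
      2 ^ (min (5 * 2 ^ (q - 3) - q - 1) d) * (6 * min (5 * 2 ^ (q - 4) - q) d) *
        chooseD ((q + 3) * d + 2 * q - 2) q) ≤
    7 * 2 ^ (d - q) * chooseD (p + q) q * (6 * min (5 * 2 ^ (q - 4) - q) d * min (5 * 2 ^ (q - 3) - q - 1) d)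

/-- **THE RATIO STEP**: `(p + 1)·C(n + 1, j) ≤ (p + q + 1)·C(n, j)` for `j ≤ q` and `p + q ≤ n` — the binomial
`C(n, j)` grows by at most the factor `(p + q + 1)/(p + 1)` of `C(p + q, q)` when `n` grows by one. -/
theorem choose_succ_ratio (n p q j : ℕ) (hj : j ≤ q) (hn : p + q ≤ n) :
    (p + 1) * (n + 1).choose j ≤ (p + q + 1) * n.choose j := by
  have hjn : j ≤ n := by omega
  have h := Nat.choose_mul_succ_eq n j
  -- `n.choose j * (n + 1) = (n + 1).choose j * (n + 1 - j)`
  have hpos : 0 < n + 1 - j := by omega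
  apply Nat.le_of_mul_le_mul_right _ hpos
  calc (p + 1) * (n + 1).choose j * (n + 1 - j) = (p + 1) * ((n + 1).choose j * (n + 1 - j)) := by ring
    _ = (p + 1) * (n.choose j * (n + 1)) := by rw [h]
    _ = n.choose j * ((p + 1) * (n + 1)) := by ring
    _ ≤ n.choose j * ((p + q + 1) * (n + 1 - j)) := by
        apply Nat.mul_le_mul_left
        -- `(p+1)(n+1) ≤ (p+q+1)(n+1−j)` ⟺ `j(p+q+1) ≤ q(n+1)`
        have h1 : j * (p + q + 1) ≤ q * (n + 1) := Nat.mul_le_mul hj (by omega)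
        have h2 : (p + q + 1) * (n + 1 - j) + (p + q + 1) * j = (p + q + 1) * (n + 1) := by
          rw [← Nat.mul_add, Nat.sub_add_cancel (by omega)]
        nlinarith
    _ = (p + q + 1) * n.choose j * (n + 1 - j) := by ring

/-- **`KeyP` IS MONOTONE IN THE RANK**: `KeyP q p d → KeyP q (p + 1) d` for `q ≤ d` (every `p`-dependent factor of the
left side is a binomial `C(n, j)`, `j ≤ q`, `n ≥ p + q`, and grows by at most the factor of `C(p + q, q)`, which grows
by exactly `(p + q + 1)/(p + 1)`). -/
theorem keyP_succ (q p d : ℕ) (hd : q ≤ d) (h : KeyP q p d) : KeyP q (p + 1) d := by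
  unfold KeyP A6D at h ⊢
  simp only [chooseD_eq] at h ⊢
  set μs := min (5 * 2 ^ (q - 4) - q) d with hμs
  set μb := min (5 * 2 ^ (q - 3) - q - 1) d with hμb
  set CY := ((q + 3) * d + 2 * q - 2).choose q with hCY
  set C4 := (2 * d + 2 * q - 2).choose 4 with hC4
  -- the four ratio steps
  have e1 : p + 1 + d = p + d + 1 := by ring
  rw [e1]
  have e4 : 2 * d + 2 * q - 6 + (p + d + 1) = 2 * d + 2 * q - 6 + (p + d) + 1 := by omega
  rw [e4]
  have h1 := choose_succ_ratio (p + d) p q q le_rfl (by omega)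
  have h2 := choose_succ_ratio (p + d) p q (q - 2) (by omega) (by omega)
  have h3 := choose_succ_ratio (p + d) p q (q - 3) (by omega) (by omega)
  have h4 := choose_succ_ratio (2 * d + 2 * q - 6 + (p + d)) p q (q - 4) (by omega) (by omega)
  -- `C(p+1+q, q)·(p+1) = C(p+q, q)·(p+q+1)`
  have hR : (p + q).choose q * (p + q + 1) = (p + 1 + q).choose q * (p + 1) := by
    have := Nat.choose_mul_succ_eq (p + q) q
    rw [show p + q + 1 - q = p + 1 by omega] at this
    rw [show p + 1 + q = p + q + 1 by ring]
    exact this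
  have hpos : 0 < p + 1 := by omega
  apply Nat.le_of_mul_le_mul_right _ hpos
  calc 8 * ((p + d + 1).choose q * (6 * μs * μb) +
        2 ^ μs * μb * (3 * (d * (d + 1)) * (p + d + 1).choose (q - 2) +
          2 * (d * (d + 1) * (d + 2)) * (p + d + 1).choose (q - 3) +
          6 * (C4 * (2 * d + 2 * q - 6 + (p + d) + 1).choose (q - 4))) +
        2 ^ μb * (6 * μs) * CY) * (p + 1)
      = 8 * ((6 * μs * μb) * ((p + 1) * (p + d + 1).choose q) +
        2 ^ μs * μb * (3 * (d * (d + 1)) * ((p + 1) * (p + d + 1).choose (q - 2)) +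
          2 * (d * (d + 1) * (d + 2)) * ((p + 1) * (p + d + 1).choose (q - 3)) +
          6 * (C4 * ((p + 1) * (2 * d + 2 * q - 6 + (p + d) + 1).choose (q - 4)))) +
        2 ^ μb * (6 * μs) * CY * (p + 1)) := by ring
    _ ≤ 8 * ((6 * μs * μb) * ((p + q + 1) * (p + d).choose q) +
        2 ^ μs * μb * (3 * (d * (d + 1)) * ((p + q + 1) * (p + d).choose (q - 2)) +
          2 * (d * (d + 1) * (d + 2)) * ((p + q + 1) * (p + d).choose (q - 3)) +
          6 * (C4 * ((p + q + 1) * (2 * d + 2 * q - 6 + (p + d)).choose (q - 4)))) +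
        2 ^ μb * (6 * μs) * CY * (p + q + 1)) := by gcongr; omega
    _ = (8 * ((p + d).choose q * (6 * μs * μb) +
        2 ^ μs * μb * (3 * (d * (d + 1)) * (p + d).choose (q - 2) +
          2 * (d * (d + 1) * (d + 2)) * (p + d).choose (q - 3) +
          6 * (C4 * (2 * d + 2 * q - 6 + (p + d)).choose (q - 4))) +
        2 ^ μb * (6 * μs) * CY)) * (p + q + 1) := by ring
    _ ≤ 7 * 2 ^ (d - q) * (p + q).choose q * (6 * μs * μb) * (p + q + 1) := Nat.mul_le_mul_right _ h
    _ = 7 * 2 ^ (d - q) * (6 * μs * μb) * ((p + q).choose q * (p + q + 1)) := by ring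
    _ = 7 * 2 ^ (d - q) * (6 * μs * μb) * ((p + 1 + q).choose q * (p + 1)) := by rw [hR]
    _ = 7 * 2 ^ (d - q) * (p + 1 + q).choose q * (6 * μs * μb) * (p + 1) := by ring

/-- **`KeyP` AT `p₀` GIVES `KeyP` AT EVERY `p ≥ p₀`** (`q ≤ d`). -/
theorem keyP_mono (q d p₀ p : ℕ) (hd : q ≤ d) (hp : p₀ ≤ p) (h : KeyP q p₀ d) : KeyP q p d := by
  induction p, hp using Nat.le_induction with
  | base => exact h
  | succ p _ ih => exact keyP_succ q p d hd ih

/-- **THE KEY GIVES `(P_d)`**: `KeyP q p d` implies the assembled inequality of `c025_core_lin2_of_poly` for every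
`A`, `B`, `W_s`, `W_b` with `W_s·μ_s ≤ 2^{μ_s}`, `W_b·μ_b ≤ 2^{μ_b}`, `6A ≤ A6`, `B ≤ C((q+3)d + 2q − 2, q)`
(`q ≥ 8`, `d ≥ q + 1`: both weight indices are positive). -/
theorem poly_of_keyP (q p d : ℕ) (hq : 8 ≤ q) (hd : q + 1 ≤ d) (hkey : KeyP q p d)
    (A B : ℕ) (Ws Wb : ℚ)
    (hWs : Ws * (min (5 * 2 ^ (q - 4) - q) d : ℕ) ≤ 2 ^ (min (5 * 2 ^ (q - 4) - q) d))
    (hWb : Wb * (min (5 * 2 ^ (q - 3) - q - 1) d : ℕ) ≤ 2 ^ (min (5 * 2 ^ (q - 3) - q - 1) d))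
    (hA : 6 * A ≤ 3 * (d * (d + 1)) * (p + d).choose (q - 2) + 2 * (d * (d + 1) * (d + 2)) * (p + d).choose (q - 3) +
        6 * ((2 * d + 2 * q - 2).choose 4 * (2 * d + 2 * q - 6 + (p + d)).choose (q - 4)))
    (hB : B ≤ ((q + 3) * d + 2 * q - 2).choose q) :
    8 * (((p + d).choose q : ℚ) + Ws * A + Wb * B) ≤ 7 * 2 ^ (d - q) * ((p + q).choose q : ℚ) := by
  have hx := le_two_pow_sub_four q (by omega)
  obtain ⟨-, -, hq3, h23⟩ := two_pow_facts2 q hq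
  unfold KeyP A6D at hkey
  simp only [chooseD_eq] at hkey
  set μs := min (5 * 2 ^ (q - 4) - q) d with hμs
  set μb := min (5 * 2 ^ (q - 3) - q - 1) d with hμb
  set A6 := 3 * (d * (d + 1)) * (p + d).choose (q - 2) + 2 * (d * (d + 1) * (d + 2)) * (p + d).choose (q - 3) +
      6 * ((2 * d + 2 * q - 2).choose 4 * (2 * d + 2 * q - 6 + (p + d)).choose (q - 4)) with hA6
  set CY := ((q + 3) * d + 2 * q - 2).choose q with hCY
  set C1 := (p + d).choose q with hC1
  set C2 := (p + q).choose q with hC2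
  have hμs1 : 1 ≤ μs := by rw [hμs]; exact le_min (by omega) (by omega)
  have hμb1 : 1 ≤ μb := by rw [hμb]; exact le_min (by omega) (by omega)
  have hk : (8 : ℚ) * ((C1 : ℚ) * (6 * μs * μb) + 2 ^ μs * μb * A6 + 2 ^ μb * (6 * μs) * CY) ≤
      7 * 2 ^ (d - q) * C2 * (6 * μs * μb) := by exact_mod_cast hkey
  have hAq : (6 * A : ℚ) ≤ A6 := by exact_mod_cast hA
  have hBq : (B : ℚ) ≤ CY := by exact_mod_cast hB
  have hμsq : (0 : ℚ) < μs := by exact_mod_cast hμs1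
  have hμbq : (0 : ℚ) < μb := by exact_mod_cast hμb1
  have hA0 : (0 : ℚ) ≤ A := Nat.cast_nonneg _
  have hB0 : (0 : ℚ) ≤ B := Nat.cast_nonneg _
  have h1 : Ws * A * (6 * μs * μb) ≤ 2 ^ μs * μb * A6 := by
    calc Ws * A * (6 * μs * μb) = (Ws * μs) * ((6 * A) * μb) := by ring
      _ ≤ 2 ^ μs * ((6 * A) * μb) := mul_le_mul_of_nonneg_right hWs (by positivity)
      _ ≤ 2 ^ μs * (A6 * μb) := by gcongr
      _ = 2 ^ μs * μb * A6 := by ring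
  have h2 : Wb * B * (6 * μs * μb) ≤ 2 ^ μb * (6 * μs) * CY := by
    calc Wb * B * (6 * μs * μb) = (Wb * μb) * (B * (6 * μs)) := by ring
      _ ≤ 2 ^ μb * (B * (6 * μs)) := mul_le_mul_of_nonneg_right hWb (by positivity)
      _ ≤ 2 ^ μb * (CY * (6 * μs)) := by gcongr
      _ = 2 ^ μb * (6 * μs) * CY := by ring
  have hpos : (0 : ℚ) < 6 * μs * μb := by positivity
  have hmain : 8 * ((C1 : ℚ) + Ws * A + Wb * B) * (6 * μs * μb) ≤ 7 * 2 ^ (d - q) * (C2 : ℚ) * (6 * μs * μb) := by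
    have e : 8 * ((C1 : ℚ) + Ws * A + Wb * B) * (6 * μs * μb) =
        8 * ((C1 : ℚ) * (6 * μs * μb) + Ws * A * (6 * μs * μb) + Wb * B * (6 * μs * μb)) := by ring
    rw [e]
    linarith
  exact le_of_mul_le_mul_right hmain hpos

/-- Two evaluated half-rows make one row: `∀ t < a, P t` and `∀ t < b, P (a + t)` give `∀ t < a + b, P t`. -/
theorem ball_lt_add (P : ℕ → Prop) (a b : ℕ) (h1 : ∀ t < a, P t) (h2 : ∀ t < b, P (a + t)) :
    ∀ t < a + b, P t := by
  intro t ht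
  rcases Nat.lt_or_ge t a with h | h
  · exact h1 t h
  · have := h2 (t - a) (by omega)
    rwa [show a + (t - a) = t by omega] at this

end Explicit

variable {α : Type}

/-- **THE CORE CELL FROM ITS KEY**: the `e`-free core at level `q ≥ 8`, corank `q + 1 ≤ d ≤ q + 2^q`, rank
`p ≥ 3(2q + 2^q) + 5`, satisfies `RLS M p q` once `KeyP q p d` holds (`c025_core_lin2_of_poly` with `poly_of_keyP`). -/
theorem c025_core_lin2_of_keyP (q : ℕ) (hq : 8 ≤ q) (M : Matroid α) [M.Finite] (p d : ℕ)
    (hd1 : q + 1 ≤ d) (hd2 : d ≤ q + 2 ^ q) (htail : 3 * (2 * q + 2 ^ q) + 5 ≤ p) (hkey : Explicit.KeyP q p d)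
    (hR : M.eRank = (p : ℕ∞)) (hn : M.E.ncard = p + d)
    (hfree : ∀ e ∈ M.E, ∃ A ⊆ M.E \ {e}, e ∉ M.closure A ∧ e ∉ M.closure ((M.E \ {e}) \ A)) :
    RLS M p q :=
  c025_core_lin2_of_poly q hq M p d hd1 hd2 htail
    (fun A B Ws Wb hWs hWb hA hB => Explicit.poly_of_keyP q p d hq hd1 hkey A B Ws Wb hWs hWb hA hB) hR hn hfree

/-- **THE LEVEL FROM ONE EVALUATED ROW**: level `q + 1 ≥ 8` for EVERY finite matroid and every `p ≥ p₀` from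
(i) level `q` for every `p ≥ p₀ − 1`, (ii) the key row `KeyP (q + 1) p₀ d` at every core corank
`q + 2 ≤ d ≤ q + 1 + 2^{q+1}` (the key is monotone in `p`: `keyP_mono`), (iii) `p₀ ≥ N₁(q + 1)` (the large-corank
theorem for the coranks `> q + 1 + 2^{q+1}`) and the tail `3(2(q+1) + 2^{q+1}) + 5 ≤ p₀`; at corank `≤ q + 1`
the level is free (`U = ∅`, Theorem M). The wrapper is `rls_succ_large_at`, rank by rank. -/
theorem c025_level_succ_of_keyP_row (q : ℕ) (hq : 7 ≤ q) (p₀ : ℕ)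
    (hN : 2 ^ (q + 1 + 1) + 2 * (q + 1) ^ 2 + 4 * (q + 1) + 4 ≤ p₀)
    (htail : 3 * (2 * (q + 1) + 2 ^ (q + 1)) + 5 ≤ p₀)
    (hrow : ∀ t < 2 ^ (q + 1), Explicit.KeyP (q + 1) p₀ (q + 2 + t))
    (hprev : ∀ (M : Matroid α) [M.Finite] (p : ℕ), p₀ - 1 ≤ p → RLS M p q) :
    ∀ (M : Matroid α) [M.Finite] (p : ℕ), p₀ ≤ p → RLS M p (q + 1) := by
  intro M _ p hp
  have h2q : 2 ≤ 2 ^ (q + 1 + 1) := by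
    calc 2 = 2 ^ 1 := by norm_num
      _ ≤ 2 ^ (q + 1 + 1) := Nat.pow_le_pow_right (by norm_num) (by omega)
  refine rls_succ_large_at (α := α) q (q + 1) p (by omega) (fun M' _ => hprev M' (p - 1) (by omega)) ?_ ?_ M
  · -- corank `≤ q + 1`: `U = ∅` or Theorem M
    intro M' _ hn
    rcases Nat.lt_or_ge M'.E.ncard (p + (q + 1)) with h | h
    · exact RLS_of_ncard_lt M' h
    · exact RLS_of_ncard_eq M' (by omega)
  · -- the core at level `q + 1`, corank `d ≥ q + 2`
    intro M' _ hR hbig hfree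
    rcases Nat.lt_or_ge M'.E.ncard (p + (q + 1) + 2 ^ (q + 1) + 1) with h | h
    · have hkey0 := hrow (M'.E.ncard - p - (q + 2)) (by omega)
      rw [show q + 2 + (M'.E.ncard - p - (q + 2)) = M'.E.ncard - p by omega] at hkey0
      have hkey := Explicit.keyP_mono (q + 1) (M'.E.ncard - p) p₀ p (by omega) hp hkey0
      exact c025_core_lin2_of_keyP (q + 1) (by omega) M' p (M'.E.ncard - p) (by omega) (by omega)
        (by omega) hkey hR (by omega) hfree
    · exact c025_core_explicit_large' (q + 1) (by omega) M' p (by omega) hR (by omega) hfree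

end ThmN

end PercRepro
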